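/-
HarnessLib.Audit.Check — NATIVE obligation-graph audit COMMANDS (D-0027 §2.1: layer invariant, negative edges, no vendored
facts, tree connectivity). Imports Lean + Batteries' env-linter basics + HarnessLib.Audit.Tags; no Summits /
Literature import (no cycle). Elaboration happens on the Lean farm; the gate reads ONE JSON info line per command.
Imported ONLY by the gate's probe/scratch copies and the fixtures — never by tree files (split 2026-08-16: every edit of
the commands used to rebuild everything downstream of the route files). Tree files import `HarnessLib.Audit` (= the
stable `HarnessLib.Audit.Tags` attributes); the gate appends `import HarnessLib.Audit.Check` + the commands to the copy it
elaborates. Adversarial fixtures + farm test: harness/gate/tests/h21_audit/*.lean, harness/gate/tests/test_h21_audit.sh.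
-/
import Lean
import Batteries.Tactic.Lint.Basic
import HarnessLib.Attr
import HarnessLib.Audit.Tags

/-!
# Native audit commands

* `#h21_check_closes "route-id" [Fq.Statement] ["nonce"]` — the LAYER INVARIANT for one route, read off the ELABORATED
  TYPE of the unique `@[closes "route-id"]` theorem of the current file:
  (i) conclusion = a `@[summit_statement]` decl BY NAME, = `Fq.Statement` when given (`¬ S` / `S → False` ⇒ refutation
  route, `"negative": true`); the statement's tag must have been applied in this file or in the statement's own module
  — the telescope is opened with `forallTelescope` (no `whnf`, no unfolding), so `abbrev S' := S` concluded as `S'`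
  FAILS with `glue.conclusion-mismatch` on purpose (by-name policy: the parent is a NAME, never a definiens);
  (ii) every hypothesis's head constant is a `@[route_item "route-id"]` decl whose tag was applied by the module that
  DECLARES it — this file, or an imported gate-written route module `Summits.….Theses.<Slug>` when the deciding theorem
  lives in a `Closes.lean` beside it (worker modules can neither tag foreign decls into a route nor their own) — or a
  `@[route_premise "route-id"]` decl tagged here — any other `Prop` binder is `glue.extra-hypothesis`, and so is a data
  binder nobody depends on (an uninhabited parameter would prove anything);
  (iii) `Lean.collectAxioms` ⊆ {propext, Classical.choice, Quot.sound} — `sorryAx` ⇒ `glue.sorry`, anything else ⇒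
  `glue.axiom`. It NEVER throws: every outcome is one info message, a single line of compact JSON
  `{"h21_check_closes": r, "route": r, "ok": …, "codes": [...], "details": [{code, decl, term, fix}], "theorem": …,
  "conclusion": …, "negative": …, "hypotheses": [...], "params": [...], "axioms": [...], "nonce"?: …, "v": 1}`.
  (v) item CONE (`closesCone`): `cone: {items, cruxes, in_cone, binder_used, glue_used, derived, unused, kill_path,
  kill_witnesses, proved, leaves, leaves_total, kinds_known}`; a declared crux outside the cone ⇒ `glue.unused-crux` — advisory (`codes_advisory`) unless
  `set_option h21.unusedCruxBlocking true`, then a failing code.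
  (iv) crux-only (human ruling 2026-08-16): every item hypothesis must carry ledger kind `crux`
  (`@[route_item "r" "crux"]`) — others ⇒ `glue.non-crux-hypothesis` (`non_crux` lists them; one-argument tags pass as
  `unknown_kind` during the transition; `route_premise` hypotheses are exempt).
  Codes: glue.missing · glue.multiple · glue.conclusion-mismatch · glue.extra-hypothesis · glue.non-crux-hypothesis ·
  glue.sorry · glue.axiom · audit.error (internal failure, still reported as JSON, ok=false).
  CONSUMER RULES (gate): fail CLOSED — no line / >1 line carrying the marker / farm error ⇒ not ok; the marker line
  must be the LAST info message of the file (the gate appends the command last; anything earlier is forged); compare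
  `conclusion` with the registry's FQ statement name; echo-check `nonce` if one was rendered.
* `#h21_tree_audit Summit.S.Sub` — classify every declaration whose name has that prefix (imported project modules
  + this file): statement · route_item · route_premise · stub · conjecture · closes · refutes:D · refutes.conditional ·
  proof-of-item · proof.conditional · support · def · proved-helper · vendored-fact · axiom · orphan; edge classes carry
  `closed` (= collectAxioms ⊆ whitelist, the SOLE credit test). One info line
  `{"h21_tree_audit": ns, "namespace": ns, "counts": {…}, "items": [{decl, class, reason, module, closed?, target?}], …}`.
* `#h21_cone "route-id"` — the closes cone (as in the verdict) computed from any downstream vantage module that imports the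
  route file and its proof modules (witnesses for proved/derived/kill_path live downstream of the route file).
* `#h21_route_deps "route-id"` — the PROJECT-side dependency cone of a route (roots: its local items/stubs, its closes
  theorem, local `_holds`/item proofs; Mathlib & co. are the trusted floor), one info line keyed `h21_route_deps` with per
  constant `{const, module, kind, axioms, sorry, holds[]?, cite_only?, route_item_of}` — the gate derives
  `deps_unproved[]` / `staffable` from it (human rule 2026-08-15: a thesis is staffed only when its dependency chain is
  proved down to Mathlib, its own items excepted). Rendered BEFORE `#h21_check_closes` (whose line stays last).
* `#h21_ground "route-id"` — cheap grounding of the route's local items: tactic batteries for trivially-true /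
  false-with-witness / vacuous-antecedent, plus unused-binder and name-shadow checks; one info line keyed `h21_ground`
  (rendered before `#h21_route_deps`; the closes verdict stays the last line).
* `#h21_check_skeleton "<crux-item>" Crux.FQ stub…` — A12 skeleton audit of a seat's Line file: a theorem concludes the
  crux BY NAME, sorries only inside the declared stubs, no axioms; one info line keyed `h21_check_skeleton`.
* `#h21_file_audit` — the tree-audit classification restricted to the declarations of THIS file (the seat-side
  self-check `harness/cli/lean check` appends; advisory); one info line keyed `h21_file_audit`; `ok` false on any
  vendored-fact / orphan / axiom / conditional / not-closed edge.
* env linters (Batteries `#lint` framework, run by `#lint` in any file / `lake exe runLinter`): `h21VendoredFact`,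
  `h21ConditionalProof` — the per-declaration checks of the tree audit, for interactive use.
-/

open Lean Meta Elab Command

namespace HarnessLib.Audit

/-- The axioms a CLOSED proof may depend on (gate whitelist). -/
def axiomWhitelist : List Name := [``propext, ``Classical.choice, ``Quot.sound]

/-- Truncate a string to `n` characters (with an ellipsis). -/
def trunc (s : String) (n : Nat) : String :=
  if s.length ≤ n then s else String.ofList (s.toList.take n) ++ "…"

private def strArr (xs : Array String) : Json := Json.arr (xs.map Json.str)

/-- One finding: machine code + declaration + offending term + one-line fix. -/
structure Detail where
  code : String
  decl : Name := .anonymous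
  term : String := ""
  fix  : String := ""
  deriving Inhabited, Repr

def Detail.toJson (d : Detail) : Json :=
  Json.mkObj [("code", d.code), ("decl", d.decl.toString), ("term", d.term), ("fix", d.fix)]

/-! ## Tag index -/

/-- Tags indexed by declaration. -/
structure TagIndex where
  tags   : Array Tag
  byDecl : Std.HashMap Name (Array Tag)

def TagIndex.ofEnv (env : Environment) : TagIndex := Id.run do
  let tags := allTags env
  let mut byDecl : Std.HashMap Name (Array Tag) := {}
  for t in tags do
    byDecl := byDecl.insert t.decl ((byDecl.getD t.decl #[]).push t)
  return { tags, byDecl }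

def TagIndex.of (ix : TagIndex) (n : Name) : Array Tag := ix.byDecl.getD n #[]

def TagIndex.hasAttr (ix : TagIndex) (n attr : Name) : Bool := (ix.of n).any (·.attr == attr)

def TagIndex.isTagged (ix : TagIndex) (n : Name) : Bool := (ix.of n).any fun t => t.attr != `refutes && t.attr != `route_item_kind

/-- Ledger kind recorded with `@[route_item "r" "kind"]` (`none` = one-argument form, kind unknown). -/
def TagIndex.itemKind? (ix : TagIndex) (n : Name) : Option String :=
  ((ix.of n).find? (·.attr == `route_item_kind)).map (·.arg)

/-- The obligation kinds a decl carries (statement / route_item / route_premise / stub), for messages. -/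
def TagIndex.kinds (ix : TagIndex) (n : Name) : List String :=
  ((ix.of n).toList.map fun t => if t.arg.isEmpty then t.attr.toString else s!"{t.attr} {t.arg}").eraseDups

/-- Module that DECLARES `n` (`none` = the current file). -/
def declModule? (env : Environment) (n : Name) : Option Name :=
  (env.getModuleIdxFor? n).map fun i => (moduleName? env i.toNat).getD `_unknown

/-- A gate-written route module: `Summits.<S>[.<Sub>].Theses.<Slug>` (only the gate writes under `Theses/`). -/
def isRouteModule (m : Name) : Bool :=
  m.getRoot == `Summits && m.components.contains `Theses

def moduleStr (env : Environment) (n : Name) : String :=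
  match declModule? env n with
  | some m => m.toString
  | none => env.mainModule.toString

/-! ## Glue analysis (shared by `#h21_check_closes`, the tree audit and the env linters) -/

/-- Result of reading one glue-shaped type `H₁ → … → Hₖ → C`. -/
structure GlueReport where
  codes      : Array String := #[]
  details    : Array Detail := #[]
  conclusion : Name := .anonymous
  negative   : Bool := false
  hypotheses : Array Name := #[]
  extraHyps  : Array String := #[]
  params     : Array String := #[]
  axioms     : Array Name := #[]
  deriving Inhabited

namespace GlueReport

def push (r : GlueReport) (d : Detail) : GlueReport :=
  { r with codes := if r.codes.contains d.code then r.codes else r.codes.push d.code,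
           details := r.details.push d }

def ok (r : GlueReport) : Bool := r.codes.isEmpty

/-- Axioms outside the whitelist. -/
def badAxioms (r : GlueReport) : Array Name := r.axioms.filter fun a => !axiomWhitelist.contains a

end GlueReport

private def ppTerm (e : Expr) : MetaM String := do
  let fmt ← try ppExpr e catch _ => pure (format (toString e))
  return trunc (fmt.pretty 100) 300

/-- Conclusion split: `¬ T` ↦ (negative, T); the `T → False` spelling is handled by the caller. -/
private def splitNot (body : Expr) : Bool × Expr :=
  match body.not? with
  | some t => (true, t)
  | none => (false, body)

/--
Read the elaborated type of `thm` as glue: open the ∀-telescope WITHOUT reducing (by-name policy), check the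
conclusion head with `isTarget`, every hypothesis head with `admissible`, and collect axioms.
`what` names the expected conclusion in fix texts; `hypWhat` names the admissible hypotheses.
Never throws for analysable input (callers still wrap it).
-/
def analyseGlue (thm : Name) (type : Expr) (isTarget : Name → Bool) (admissible : Name → Bool)
    (what hypWhat : String) (explain : Name → String := fun _ => "") : MetaM GlueReport := do
  let rep ← forallTelescope type fun xs body => do
    let mut rep : GlueReport := {}
    let body ← instantiateMVars body
    -- conclusion ---------------------------------------------------------------------------------------------
    let mut (neg, tgt) := splitNot body
    let mut hs := xs
    if !neg && body.isConstOf ``False && 0 < xs.size then      -- `… → D → False` spelling of `¬ D`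
      let lastTy ← instantiateMVars (← inferType xs.back!)
      neg := true; tgt := lastTy; hs := xs.pop
    rep := { rep with negative := neg }
    match tgt.getAppFn with
    | .const c _ =>
      rep := { rep with conclusion := c }
      let argsOk := tgt.getAppArgs.all fun a => a.isFVar && hs.contains a
      if !isTarget c then
        let extra := explain c
        rep := rep.push { code := "glue.conclusion-mismatch", decl := thm, term := (← ppTerm body),
                          fix := s!"conclude {what} BY NAME (write its declared name as the result type; an `abbrev`/`def` alias or an unfolded restatement is not the parent){extra}" }
      else if !argsOk then
        rep := rep.push { code := "glue.conclusion-mismatch", decl := thm, term := (← ppTerm body),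
                          fix := s!"the conclusion applies {c} to terms that are not the theorem's own bound parameters; conclude {what} by name" }
    | _ =>
      rep := rep.push { code := "glue.conclusion-mismatch", decl := thm, term := (← ppTerm body),
                        fix := s!"the conclusion is not a named declaration; conclude {what} BY NAME" }
    -- hypotheses ---------------------------------------------------------------------------------------------
    for x in hs do
      let ld ← x.fvarId!.getDecl
      let ty ← instantiateMVars ld.type
      match ty.getAppFn.constName? with
      | some c =>
        if admissible c then
          rep := { rep with hypotheses := rep.hypotheses.push c }
          continue
      | none => pure ()
      let shown := s!"({ld.userName} : {← ppTerm ty})"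
      if ← isProp ty then
        let extra := match ty.getAppFn.constName? with
          | some c => explain c
          | none => ""
        rep := { rep with extraHyps := rep.extraHyps.push shown }
        rep := rep.push { code := "glue.extra-hypothesis", decl := thm, term := shown,
                          fix := s!"hypotheses must be exactly {hypWhat}, each by name; list this proposition as one of them (route edit / declare the stub) or discharge it inside the proof{extra}" }
      else
        -- a data binder is admissible only if the conclusion or another binder depends on it
        let fv := x.fvarId!
        let mut used := tgt.containsFVar fv
        unless used do
          for y in xs do
            if y != x && (← instantiateMVars (← inferType y)).containsFVar fv then
              used := true; break
        if used then
          rep := { rep with params := rep.params.push shown }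
        else
          rep := { rep with extraHyps := rep.extraHyps.push shown }
          rep := rep.push { code := "glue.extra-hypothesis", decl := thm, term := shown,
                            fix := "unused data binder: remove it (a parameter of an uninhabited type would make the theorem vacuous)" }
    return rep
  -- axioms -----------------------------------------------------------------------------------------------------
  let axs ← collectAxioms thm
  let mut rep := { rep with axioms := axs }
  for a in axs do
    if a == ``sorryAx then
      rep := rep.push { code := "glue.sorry", decl := thm, term := "sorryAx",
                        fix := "the theorem (or something it uses) is not proved: remove every sorry/admit/stub — closure is computed from the axioms of the proof term" }
    else if !axiomWhitelist.contains a then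
      rep := rep.push { code := "glue.axiom", decl := thm, term := a.toString,
                        fix := s!"depends on axiom {a} outside \{propext, Classical.choice, Quot.sound}: axioms/opaque postulates never close anything — prove it or make it an explicit listed hypothesis" }
  return rep

/-! ## `#h21_check_closes` -/

/-- JSON key / marker of the closes verdict line. -/
def checkMarker : String := "h21_check_closes"

/-- Verdict of `#h21_check_closes` before serialisation. -/
structure ClosesVerdict where
  route  : String
  thm    : Option Name := none
  report : GlueReport := {}
  nonCrux : Array Name := #[]        -- hypotheses that are items of the route but not of ledger kind `crux` (2026-08-16 ruling)
  unknownKind : Array Name := #[]    -- item hypotheses tagged without a kind (transition: pass, but shown)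
  cone : Json := Json.null           -- item cone of the deciding theorem (see `closesCone`)
  advisory : Array String := #[]     -- codes reported but not (yet) failing the verdict
  advisoryDetails : Array Detail := #[]
  deriving Inhabited

def ClosesVerdict.toJson (v : ClosesVerdict) (nonce : Option String) : Json :=
  let r := v.report
  let base : List (String × Json) := [
    (checkMarker, v.route), ("route", v.route), ("ok", r.ok), ("codes", strArr r.codes),
    ("details", Json.arr (r.details.map Detail.toJson)),
    ("theorem", match v.thm with | some t => (t.toString : Json) | none => Json.null),
    ("conclusion", if r.conclusion.isAnonymous then Json.null else (r.conclusion.toString : Json)),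
    ("negative", r.negative), ("hypotheses", strArr (r.hypotheses.map (·.toString))),
    ("extra", strArr r.extraHyps), ("params", strArr r.params),
    ("non_crux", strArr (v.nonCrux.map (·.toString))), ("unknown_kind", strArr (v.unknownKind.map (·.toString))),
    ("cone", v.cone), ("codes_advisory", strArr v.advisory), ("details_advisory", Json.arr (v.advisoryDetails.map Detail.toJson)),
    ("axioms", strArr (r.axioms.map (·.toString))), ("v", (1 : Nat))]
  Json.mkObj (base ++ (match nonce with | some n => [("nonce", (n : Json))] | none => []))

/-- Module roots that never contain obligation-graph declarations (skipped when enumerating candidates). -/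
def libraryRoots : List Name :=
  [`Init, `Std, `Lean, `Lake, `Mathlib, `Batteries, `Aesop, `Qq, `ProofWidgets, `ImportGraph, `Plausible, `LeanSearchClient, `Cli, `Archive, `Counterexamples]

/-- Is `n` a PROJECT constant (declared in this file or in a non-library module)? Library = the trusted floor. -/
def isProjectConst (env : Environment) (n : Name) : Bool :=
  match declModule? env n with
  | none => true
  | some m => !libraryRoots.contains m.getRoot

/-! ### `holds` witnesses (shared by the tree/file audit's `proved-helper` class and `#h21_route_deps`) -/

/-- Does theorem type `tType` state exactly `X` applied to its own binders (`X_holds : X`, `X_holds {K} [Field K] : X K`)? No reduction. -/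
def statesExactly (X : Name) (tType : Expr) : MetaM Bool :=
  forallTelescope tType fun xs body => do
    let body ← instantiateMVars body
    return body.getAppFn.isConstOf X && body.getAppArgs.toList == xs.toList

/-- Theorems of every imported PROJECT module + this file, indexed by the head constant of their type's ∀-body
(witnesses usually live DOWNSTREAM of the decl they prove — `Theorems/…` importing the route file — so a same-module
search is not enough; from a vantage module that imports those proofs this index sees them). -/
def projectHeadIndex (env : Environment) : Std.HashMap Name (Array Name) := Id.run do
  let mut m : Std.HashMap Name (Array Name) := {}
  for h : i in [0:env.header.modules.size] do
    if libraryRoots.contains env.header.modules[i].module.getRoot then continue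
    let some md := env.header.moduleData[i]? | continue
    for k in md.constNames do
      if let some (.thmInfo ti) := env.find? k then
        if let some hd := ti.type.getForallBody.getAppFn.constName? then
          m := m.insert hd ((m.getD hd #[]).push k)
  m := env.constants.foldStage2 (fun m k ci => match ci with
    | .thmInfo ti => match ti.type.getForallBody.getAppFn.constName? with
      | some hd => m.insert hd ((m.getD hd #[]).push k)
      | none => m
    | _ => m) m
  return m

/-- Memo cell for `projectHeadIndex` (built on first use within one command). -/
abbrev HeadIndexRef := IO.Ref (Option (Std.HashMap Name (Array Name)))

/-- Lazily memoised "theorems anywhere in the project headed by X" lookup. -/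
def headedInProject (env : Environment) (cache : HeadIndexRef) (X : Name) : BaseIO (Array Name) := do
  match ← cache.get with
  | some m => return m.getD X #[]
  | none =>
    let m := projectHeadIndex env
    cache.set (some m)
    return m.getD X #[]

/-- One `holds` witness of a Prop-valued constant. -/
structure Witness where
  thm    : Name
  axioms : Array Name
  deriving Inhabited

def Witness.sorry (w : Witness) : Bool := w.axioms.contains ``sorryAx
/-- Kernel-closed: no sorry, axioms ⊆ whitelist. -/
def Witness.clean (w : Witness) : Bool := w.axioms.all fun a => axiomWhitelist.contains a

/-- Witnesses that `X` HOLDS: `X_holds`, `X.holds`, and every project theorem in the environment (via `sameModule X`, now the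
project-wide head index) whose type is EXACTLY `X` on its own binders (conditional discharges `X_holds (h : Side) : X` do
not count), each with its axioms. Only what the current vantage module IMPORTS is visible. -/
def holdsWitnesses (sameModule : Name → BaseIO (Array Name)) (X : Name) : MetaM (Array Witness) := do
  let env ← getEnv
  let mut cands : Array Name := #[]
  match X with
  | .str p s => cands := cands.push (.str p (s ++ "_holds"))
  | _ => pure ()
  cands := cands.push (.str X "holds")
  cands := cands ++ (← liftM (n := BaseIO) (sameModule X))
  let mut out : Array Witness := #[]
  let mut seen : Std.HashSet Name := {}
  for w in cands do
    if seen.contains w then continue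
    seen := seen.insert w
    let some wi := env.find? w | continue
    unless wi matches .thmInfo _ do continue
    if ← statesExactly X wi.type then
      out := out.push { thm := w, axioms := (← collectAxioms w) }
  return out

register_option h21.unusedCruxBlocking : Bool := {
  defValue := false
  descr := "#h21_check_closes: a declared crux outside the deciding theorem's item cone (glue.unused-crux) fails the verdict (else advisory)" }

/-- Item CONE of a deciding theorem (coordinator/human 2026-08-16): start from the constants used by its TYPE and PROOF TERM;
route items of `route` are nodes expanded through their own type + definiens, everything else is an unexpanded leaf.
Reports (short names for items): `binder_used` — item hypotheses whose bound variable occurs in the proof body;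
`glue_used` — items reached through ANOTHER item's statement; `derived` — in-cone items that are the conclusion of a
PROVED implication-item (clean `holds` witness) all of whose antecedent items are proved or in the cone; `unused` —
declared cruxes (kind `crux`; all items when no kinds are recorded) outside the cone; `leaves` — non-item constants at
the boundary (project constants first, capped at 40; `leaves_total`); `kill_path` — items that negate a closes hypothesis H
(own definiens `… → ¬H` / `… → H → False`, or antecedent of a landed theorem `X₁ → … → ¬H` over items; witnesses in
`kill_witnesses`), which are NOT `unused` (coordinator ruling 2026-08-16). -/
def closesCone (env : Environment) (ix : TagIndex) (route : String) (thm : Name) (isItem : Name → Bool)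
    (sameModule : Name → BaseIO (Array Name)) : MetaM Json := do
  let penv := env.setExporting false
  let some ci := penv.find? thm | return Json.null
  let items := (ix.tags.filter fun t => t.attr == `route_item && t.arg == route && isItem t.decl).map (·.decl) |>.toList.eraseDups
  let kinds := items.filterMap fun i => (ix.itemKind? i).map fun k => (i, k)
  let cruxes := if kinds.isEmpty then items else kinds.filterMap fun (i, k) => if k == "crux" then some i else none
  let short (n : Name) : String := match n with | .str _ s => s | _ => n.toString
  -- walk
  let mut inCone : Std.HashSet Name := {}
  let mut viaItem : Std.HashSet Name := {}         -- items discovered while expanding another item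
  let mut leaves : Std.HashSet Name := {}
  let mut work : Array (Name × Bool) := #[]        -- (const, discovered via an item?)
  let seeds := ci.type.getUsedConstants ++ (match ci.value? (allowOpaque := true) with | some v => v.getUsedConstants | none => #[])
  for c in seeds do work := work.push (c, false)
  while h : 0 < work.size do
    let (c, via) := work.back
    work := work.pop
    if isItem c then
      if via then viaItem := viaItem.insert c
      if inCone.contains c then continue
      inCone := inCone.insert c
      if let some ici := env.find? c then
        let used := ici.type.getUsedConstants ++ (match ici.value? with | some v => v.getUsedConstants | none => #[])
        for u in used do work := work.push (u, true)
    else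
      leaves := leaves.insert c
  -- binder_used: hypotheses whose fvar occurs in the proof body
  let binderUsed ← match ci.value? (allowOpaque := true) with
    | none => pure #[]
    | some v => lambdaTelescope v fun xs body => do
        let mut out : Array Name := #[]
        for x in xs do
          let ty ← instantiateMVars (← inferType x)
          if let some hc := ty.getAppFn.constName? then
            if isItem hc && body.containsFVar x.fvarId! then out := out.push hc
        return out
  -- derived: conclusion items of proved implication-items whose antecedent items are proved or in the cone
  let mut proved : Std.HashMap Name Bool := {}
  for i in items do
    let ws ← holdsWitnesses sameModule i
    proved := proved.insert i (ws.any (·.clean))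
  let mut derived : Array Name := #[]
  for i in items do
    unless proved.getD i false do continue
    let some (.defnInfo d) := env.find? i | continue
    let r ← forallTelescope d.value fun xs body => do
      let concl? := body.getAppFn.constName?
      let mut ants : Array Name := #[]
      for x in xs do
        let ty ← instantiateMVars (← inferType x)
        if ← isProp ty then
          match ty.getAppFn.constName? with
          | some a => ants := ants.push a
          | none => ants := ants.push `_nonconst
      return (concl?, ants)
    let (some concl, ants) := r | continue
    unless isItem concl && concl != i do continue
    if ants.all (fun a => isItem a && (inCone.contains a || proved.getD a false)) then
      unless derived.contains concl do derived := derived.push concl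
  -- kill paths (coordinator ruling 2026-08-16, negative edges first-class): an item that yields `¬ H` for a closes
  -- hypothesis H — by its own definiens (`… → ¬H` / `… → H → False`) or as an antecedent of a LANDED theorem
  -- `t : X₁ → … → ¬H` all of whose Prop antecedents are items — is in the argument with role kill_path, not unused
  let negTarget (type : Expr) : MetaM (Option Name × Array Name × Bool) :=    -- (negated head?, Prop antecedent heads, all antecedents named?)
    forallTelescope type fun xs body => do
      let mut ants : Array Name := #[]
      let mut named := true
      for x in xs do
        let ty ← instantiateMVars (← inferType x)
        if ← isProp ty then
          match ty.getAppFn.constName? with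
          | some a => ants := ants.push a
          | none => named := false
      let body ← instantiateMVars body
      match body.not? with
      | some t => return (t.getAppFn.constName?, ants, named)
      | none =>
        if body.isConstOf ``False && 0 < ants.size then
          return (some ants.back!, ants.pop, named)
        return (none, ants, named)
  let hypItems ← forallTelescope ci.type fun xs _ => do
    let mut hs : Array Name := #[]
    for x in xs do
      if let some hc := (← instantiateMVars (← inferType x)).getAppFn.constName? then
        if isItem hc then hs := hs.push hc
    return hs
  let mut killPath : Array Name := #[]
  let mut killWitness : Array (Name × Name × Name) := #[]     -- (item, hypothesis, witness)
  unless hypItems.isEmpty do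
    -- (a) items whose definiens negates a hypothesis
    for i in items do
      let some (.defnInfo d) := env.find? i | continue
      let (some h, _, _) ← negTarget d.value | continue
      if hypItems.contains h && h != i then
        unless killPath.contains i do killPath := killPath.push i
        killWitness := killWitness.push (i, h, i)
    -- (b) landed theorems `X₁ → … → ¬H` over items, in project modules + this file
    let mut thms : Array Name := #[]
    for hh : mi in [0:env.header.modules.size] do
      if libraryRoots.contains env.header.modules[mi].module.getRoot then continue
      let some md := env.header.moduleData[mi]? | continue
      for n in md.constNames do
        if let some (.thmInfo _) := env.find? n then thms := thms.push n
    thms := env.constants.foldStage2 (fun acc n c => match c with | .thmInfo _ => acc.push n | _ => acc) thms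
    for n in thms do
      let some tci := env.find? n | continue
      -- cheap prefilter: the statement must mention some hypothesis item
      let usedT := tci.type.getUsedConstants
      unless hypItems.any usedT.contains do continue
      let (some h, ants, named) ← negTarget tci.type | continue
      unless hypItems.contains h && named && !ants.isEmpty && ants.all isItem do continue
      for a in ants do
        unless killPath.contains a do killPath := killPath.push a
        killWitness := killWitness.push (a, h, n)
  let unused := cruxes.filter fun c => !inCone.contains c && !killPath.contains c
  let leavesArr := leaves.toArray.qsort Name.lt
  let projLeaves := leavesArr.filter (isProjectConst env ·)
  let otherLeaves := leavesArr.filter fun c => !isProjectConst env c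
  let shown := (projLeaves ++ otherLeaves).extract 0 40
  return Json.mkObj [
    ("items", strArr (items.toArray.map short)), ("cruxes", strArr (cruxes.toArray.map short)),
    ("in_cone", strArr ((items.filter inCone.contains).toArray.map short)),
    ("binder_used", strArr (binderUsed.map short)), ("glue_used", strArr ((items.filter viaItem.contains).toArray.map short)),
    ("derived", strArr (derived.map short)), ("unused", strArr (unused.toArray.map short)),
    ("kill_path", strArr (killPath.map short)),
    ("kill_witnesses", Json.arr (killWitness.map fun (i, h, w) => Json.mkObj [("item", (short i : Json)), ("negates", (short h : Json)), ("thm", (w.toString : Json))])),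
    ("proved", strArr ((items.filter fun i => proved.getD i false).toArray.map short)),
    ("leaves", strArr (shown.map (·.toString))), ("leaves_total", (leavesArr.size : Json)),
    ("kinds_known", (!kinds.isEmpty : Json))]

/-- The analysis behind `#h21_check_closes r` on the current environment; `expected` = the registry's statement decl
(when given, the conclusion must be THAT name — closes the "imported module tags its own fake statement" hole in-Lean). -/
def checkClosesCore (route : String) (expected : Option Name := none) (unusedCruxBlocking : Bool := false) : CommandElabM ClosesVerdict := do
  let env ← getEnv
  let ix := TagIndex.ofEnv env
  let closesTags := ix.tags.filter fun t => t.attr == `closes && t.arg == route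
  let localNames := (closesTags.filter (·.origin.isNone)).map (·.decl) |>.toList.eraseDups
  let localNames := localNames.filter env.contains
  match localNames with
  | [] =>
    let imported := (closesTags.filter (·.origin.isSome)).map (·.decl.toString)
    let hint := if imported.isEmpty then "" else s!" (ignored @[closes] tags applied in imported modules: {imported})"
    let rep := ({} : GlueReport).push
      { code := "glue.missing", term := route,
        fix := s!"no theorem tagged @[closes \"{route}\"] in this file: supply the deciding theorem `theorem closes (h₁ : Item₁) … : <Statement>` (route open/edit --closes-file){hint}" }
    return { route, report := rep }
  | t :: t' :: more =>
    let rep := ({} : GlueReport).push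
      { code := "glue.multiple", term := ", ".intercalate ((t :: t' :: more).map (·.toString)),
        fix := s!"exactly one theorem may carry @[closes \"{route}\"]" }
    return { route, report := rep }
  | [t] =>
    let ci := env.find? t |>.get!
    -- by-name + provenance: the statement tag must come from THIS file (gate-rendered) or the statement's own module;
    -- item tags must be applied here on decls declared here; premises must be tagged here.
    let isTarget (c : Name) : Bool := (expected.all (· == c)) && (ix.of c).any fun tg =>
      tg.attr == `summit_statement && (tg.origin.isNone || tg.origin == declModule? env c)
    -- an item tag counts iff it was applied by the module that DECLARES the item, and that module is this file or a
    -- gate-written ROUTE module `Summits.<S>.….Theses.<Slug>` (a `Closes.lean` beside the route file imports its items;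
    -- worker modules — Theorems/… — can neither tag someone else's decl into a route nor pass off their own)
    let admissible (c : Name) : Bool := (ix.of c).any fun tg =>
      (tg.attr == `route_item && tg.arg == route && tg.origin == declModule? env c &&
        (match declModule? env c with | none => true | some m => isRouteModule m)) ||
      (tg.attr == `route_premise && tg.arg == route && tg.origin.isNone)
    let explain (c : Name) : String :=
      let ts := ix.of c
      if expected.any (· != c) && ts.any (·.attr == `summit_statement) then
        s!" — expected the registered statement `{expected.getD .anonymous}`, not `{c}`"
      else if ts.isEmpty then
        match env.find? c with
        | some (.defnInfo d) =>
          match d.value.getAppFn.constName? with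
          | some c' => if (ix.of c').any (fun tg => tg.attr == `summit_statement || (tg.attr == `route_item && tg.arg == route))
                       then s!" — `{c}` is a definition unfolding to `{c'}`: name `{c'}` itself"
                       else ""
          | none => ""
        | _ => ""
      else
        let other := ts.filter fun tg => (tg.attr == `route_item || tg.attr == `route_premise) && tg.arg != route
        let foreign := ts.filter fun tg => tg.origin.isSome && tg.origin != declModule? env c
        (if other.isEmpty then "" else s!" — `{c}` is an item of another route ({", ".intercalate (other.toList.map (·.arg))}), not of {route}") ++
        (if foreign.isEmpty then "" else s!" — tag(s) on `{c}` were applied in imported module(s) {foreign.toList.map (·.origin.getD `_ |>.toString)} and are ignored")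
    let what := match expected with
      | some e => s!"the sub-problem Statement `{e}`"
      | none => "the sub-problem Statement (the @[summit_statement] decl)"
    let rep0 ← liftTermElabM <|
      analyseGlue t ci.type isTarget admissible what
        s!"the listed items of route {route}" explain
    -- crux-only deciding theorem (human ruling 2026-08-16): every item hypothesis must be of ledger kind `crux`
    -- (premises of a conditional bridge are exempt; one-argument tags = kind unknown pass during the transition)
    let mut rep := rep0
    let mut nonCrux : Array Name := #[]
    let mut unknownKind : Array Name := #[]
    for h in rep0.hypotheses do
      let isPremise := (ix.of h).any fun tg => tg.attr == `route_premise && tg.arg == route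
      if isPremise then continue
      match ix.itemKind? h with
      | some "crux" => pure ()
      | some k =>
        nonCrux := nonCrux.push h
        rep := rep.push { code := "glue.non-crux-hypothesis", decl := t, term := s!"{h} ({k})",
                          fix := "the deciding theorem may assume CRUX items only; prove this item as a lemma (Theorems/) and USE it inside the proof term instead of taking it as a hypothesis" }
      | none => unknownKind := unknownKind.push h
    -- item cone of the deciding theorem (glue.unused-crux: a declared crux the theorem's cone never touches)
    let isItem (c : Name) : Bool := (ix.of c).any fun tg =>
      tg.attr == `route_item && tg.arg == route && tg.origin == declModule? env c &&
        (match declModule? env c with | none => true | some m => isRouteModule m)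
    let cache : HeadIndexRef ← IO.mkRef none
    let cone ← liftTermElabM <| closesCone env ix route t isItem (headedInProject env cache)
    let mut advisory : Array String := #[]
    let mut advisoryDetails : Array Detail := #[]
    match cone.getObjVal? "kill_witnesses" with
    | .ok (.arr ws) =>
      unless ws.isEmpty do
        advisoryDetails := advisoryDetails.push { code := "cone.kill-path", decl := t, term := (Json.arr ws).compress,
                                                  fix := "informational: these items negate a closes hypothesis (negative edge / kill path) and count as part of the argument" }
    | _ => pure ()
    let unusedN := match cone.getObjValAs? (Array String) "unused" with | .ok a => a.size | .error _ => 0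
    if unusedN > 0 then
      let unusedTerm := (cone.getObjValD "unused").compress
      let unusedFix := "a declared crux that the deciding theorem's cone never touches is not part of this route's argument: use it (as a hypothesis or through an item's statement) or drop/re-kind it (route edit)"
      let d : Detail := { code := "glue.unused-crux", decl := t, term := unusedTerm, fix := unusedFix }
      if unusedCruxBlocking then rep := rep.push d
      else
        advisory := advisory.push "glue.unused-crux"
        advisoryDetails := advisoryDetails.push d
    return { route, thm := some t, report := rep, nonCrux, unknownKind, cone, advisory, advisoryDetails }

/-- `#h21_check_closes "route-id" [Expected.Statement.Name] ["nonce"]` — see the module doc. The optional identifier is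
the registry's fully-qualified statement decl (taken literally, `_root_.` stripped; recommended: the gate knows it); the
optional string is echoed as `"nonce"`. -/
syntax (name := h21CheckCloses) "#h21_check_closes " str (ppSpace ident)? (ppSpace str)? : command

@[command_elab h21CheckCloses] def elabH21CheckCloses : CommandElab := fun stx => do
  let t0 ← IO.monoMsNow
  let route := (stx[1].isStrLit?).getD ""
  let expected := if stx[2].isNone then none else some (stx[2][0].getId.replacePrefix `_root_ .anonymous)
  let nonce := if stx[3].isNone then none else stx[3][0].isStrLit?
  let blocking := h21.unusedCruxBlocking.get (← getOptions)
  let verdict ← try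
      checkClosesCore route expected blocking
    catch e =>
      let msg ← e.toMessageData.toString
      pure { route, report := ({} : GlueReport).push { code := "audit.error", term := trunc msg 500, fix := "internal audit failure — report to the HarnessLib owner; treated as NOT ok" } }
  let j := verdict.toJson nonce
  let j := match expected with
    | some e => j.setObjVal! "expected" (e.toString : Json)
    | none => j
  let j := j.setObjVal! "elapsed_ms" (((← IO.monoMsNow) - t0 : Nat) : Json)
  logInfo j.compress

/-! ## `#h21_cone` — the item cone of a route's deciding theorem from any DOWNSTREAM vantage module -/

/-- JSON key / marker of the cone line. -/
def coneMarker : String := "h21_cone"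

/-- `#h21_cone "route-id"` — `closesCone` for the `@[closes r]` theorem found in the environment (this file OR an imported
gate-written route module), from a vantage module that imports the route's proof modules, so `proved` / `derived` /
`kill_path` can see witnesses that live downstream of the route file. One info line
`{"h21_cone": r, "theorem": FQ|null, "theorem_module", "cone": {…}|null, "codes": [glue.missing|glue.multiple]?, "elapsed_ms", "v":1}`. -/
syntax (name := h21Cone) "#h21_cone " str : command

@[command_elab h21Cone] def elabH21Cone : CommandElab := fun stx => do
  let t0 ← IO.monoMsNow
  let route := (stx[1].isStrLit?).getD ""
  let j ← try (do
      let env ← getEnv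
      let ix := TagIndex.ofEnv env
      let okOrigin (n : Name) : Bool := match declModule? env n with | none => true | some m => isRouteModule m
      let cands := (ix.tags.filter fun t => t.attr == `closes && t.arg == route && t.origin == declModule? env t.decl &&
          okOrigin t.decl && env.contains t.decl).map (·.decl) |>.toList.eraseDups
      let isItem (c : Name) : Bool := (ix.of c).any fun tg =>
        tg.attr == `route_item && tg.arg == route && tg.origin == declModule? env c && okOrigin c
      match cands with
      | [t] =>
        let cache : HeadIndexRef ← IO.mkRef none
        let cone ← liftTermElabM <| closesCone env ix route t isItem (headedInProject env cache)
        pure <| Json.mkObj [(coneMarker, (route : Json)), ("theorem", (t.toString : Json)), ("theorem_module", (moduleStr env t : Json)),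
          ("cone", cone), ("codes", strArr #[]), ("elapsed_ms", (((← IO.monoMsNow) - t0 : Nat) : Json)), ("v", (1 : Json))]
      | [] => pure <| Json.mkObj [(coneMarker, (route : Json)), ("theorem", Json.null), ("cone", Json.null), ("codes", strArr #["glue.missing"]), ("v", (1 : Json))]
      | more => pure <| Json.mkObj [(coneMarker, (route : Json)), ("theorem", Json.null), ("cone", Json.null), ("codes", strArr #["glue.multiple"]),
          ("candidates", strArr (more.toArray.map (·.toString))), ("v", (1 : Json))])
    catch e =>
      let msg ← e.toMessageData.toString
      pure <| Json.mkObj [(coneMarker, (route : Json)), ("theorem", Json.null), ("cone", Json.null), ("codes", strArr #["audit.error"]), ("error", (trunc msg 500 : Json)), ("v", (1 : Json))]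
  logInfo j.compress

/-! ## `#h21_tree_audit` -/

/-- JSON key / marker of the tree-audit line. -/
def treeMarker : String := "h21_tree_audit"

/-- Is `type` a sort-valued telescope ending in `Prop` (i.e. the decl DEFINES a proposition / predicate)? -/
private def definesProp (type : Expr) : MetaM Bool :=
  forallTelescope type fun _ body => return body.isProp    -- body == Sort 0

/-- One classified declaration. -/
structure TreeItem where
  decl   : Name
  cls    : String
  reason : String := ""
  module : String := ""
  target : Option Name := none
  closed : Option Bool := none
  isThm  : Bool := false          -- proves a proposition (theorem-like)
  witnesses : Array Name := #[]   -- holds witnesses (proved-helper / vendored-fact)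
  deriving Inhabited

def TreeItem.toJson (it : TreeItem) : Json :=
  Json.mkObj <| [("decl", (it.decl.toString : Json)), ("class", (it.cls : Json)), ("reason", (it.reason : Json)), ("module", (it.module : Json))]
    ++ (match it.target with | some t => [("target", (t.toString : Json))] | none => [])
    ++ (match it.closed with | some b => [("closed", (b : Json))] | none => [])
    ++ (if it.witnesses.isEmpty then [] else [("witnesses", strArr (it.witnesses.map (·.toString)))])

/-- Skip kernel/elaborator by-products. -/
private def skipDecl (env : Environment) (n : Name) (ci : ConstantInfo) : Bool :=
  env.isAutoDecl n || n.isImplementationDetail || env.isProjectionFn n ||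
  match ci with
  | .ctorInfo _ | .recInfo _ | .quotInfo _ => true
  | _ => false

/-- First-pass classification of one declaration (cone-independent part). -/
def classifyDecl (env : Environment) (ix : TagIndex) (n : Name) (ci : ConstantInfo)
    (sameModule : Name → BaseIO (Array Name) := fun X => pure ((projectHeadIndex env).getD X #[])) :
    MetaM TreeItem := do
  let module := moduleStr env n
  let base : TreeItem := { decl := n, cls := "?", module }
  let ts := ix.of n
  -- registered obligations -----------------------------------------------------------------------------------
  if ts.any (·.attr == `summit_statement) then return { base with cls := "statement" }
  if let some t := ts.find? (·.attr == `route_item) then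
    return { base with cls := "route_item", reason := match ix.itemKind? n with | some k => s!"{t.arg} {k}" | none => t.arg }
  if let some t := ts.find? (·.attr == `route_premise) then return { base with cls := "route_premise", reason := t.arg }
  if let some t := ts.find? (·.attr == `stub) then return { base with cls := "stub", reason := t.arg }
  if ts.any (·.attr == `conjecture) then return { base with cls := "conjecture", reason := "@[conjecture] — open named conjecture (obligation node)" }
  if let .axiomInfo _ := ci then
    return { base with cls := "axiom", reason := "postulate (tree.axiom)", closed := some false }
  let anyTag (c : Name) : Bool := ix.isTagged c
  if let some t := ts.find? (·.attr == `closes) then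
    let isTarget (c : Name) : Bool := ix.hasAttr c `summit_statement
    let admissible (c : Name) : Bool := (ix.of c).any fun tg => (tg.attr == `route_item || tg.attr == `route_premise) && tg.arg == t.arg
    let rep ← analyseGlue n ci.type isTarget admissible "the Statement" s!"the items of route {t.arg}"
    return { base with cls := "closes", reason := if rep.ok then t.arg else s!"{t.arg}: {", ".intercalate rep.codes.toList}",
                       target := some rep.conclusion, closed := some rep.ok, isThm := true }
  -- theorem-like: proves a proposition ---------------------------------------------------------------------------
  let provesProp ← isProp ci.type
  if provesProp then
    let rep ← analyseGlue n ci.type anyTag anyTag "a registered obligation" "registered obligations (items / stubs / statements)"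
    let concl := rep.conclusion
    let tagged := !concl.isAnonymous && anyTag concl && !rep.codes.contains "glue.conclusion-mismatch"
    let axiomsOk := !(rep.codes.contains "glue.sorry" || rep.codes.contains "glue.axiom")
    let condl := rep.codes.contains "glue.extra-hypothesis"
    let axNote := if axiomsOk then "" else s!"; NOT closed: axioms {rep.badAxioms.toList}"
    if rep.negative && tagged then
      if condl then
        return { base with cls := "refutes.conditional", target := some concl, closed := some false, isThm := true,
                           reason := s!"¬{concl} under unregistered hypotheses {rep.extraHyps.toList} — recorded, settles nothing{axNote}" }
      return { base with cls := "refutes", target := some concl, closed := some axiomsOk, isThm := true,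
                         reason := s!"negative edge on {concl} ({", ".intercalate (ix.kinds concl)}){axNote}" }
    if ts.any (·.attr == `refutes) then      -- declared intent, wrong shape
      return { base with cls := "refutes.malformed", target := if concl.isAnonymous then none else some concl, closed := some false, isThm := true,
                         reason := s!"tagged @[refutes] but its type is not `¬ D` for a registered obligation D by name ({", ".intercalate rep.codes.toList})" }
    if !rep.negative && tagged then
      if condl then
        return { base with cls := "proof.conditional", target := some concl, closed := some false, isThm := true,
                           reason := s!"proves {concl} only under unregistered hypotheses {rep.extraHyps.toList} — displayed via closure.modulo, credits nothing{axNote}" }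
      return { base with cls := "proof-of-item", target := some concl, closed := some axiomsOk, isThm := true,
                         reason := s!"proves {concl} ({", ".intercalate (ix.kinds concl)}){axNote}" }
    return { base with cls := "thm?", isThm := true, closed := some axiomsOk }     -- support or orphan: decided by the cone
  -- definitions ------------------------------------------------------------------------------------------------
  if ← definesProp ci.type then
    let what := match ci with
      | .inductInfo _ => "inductive/structure in Prop"
      | .opaqueInfo _ => "opaque Prop"
      | .defnInfo d => if d.hints.isAbbrev then "abbrev : Prop" else "def : Prop"
      | _ => "Prop-valued constant"
    -- legacy proved material (human 2026-08-15): an untagged Prop def WITH a kernel-closed witness in the env is a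
    -- `proved-helper`, not a vendored fact (same witness detection as `#h21_route_deps` holds[])
    let ws ← holdsWitnesses sameModule n
    if let some w := ws.find? (·.clean) then
      return { base with cls := "proved-helper", closed := some true, witnesses := ws.map (·.thm),
                         reason := s!"untagged {what} with kernel-closed witness {w.thm}" }
    let wnote := if ws.isEmpty then "" else s!"; witnesses not closed: {ws.toList.map fun w => (w.thm, w.axioms.filter fun a => !axiomWhitelist.contains a)}"
    return { base with cls := "vendored-fact", witnesses := ws.map (·.thm), reason := s!"untagged {what} (tree.vendored-fact){wnote}" }
  return { base with cls := "def?" }                                              -- data/support definition: cone decides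

/-- Audit over every declaration selected by `sel` — from the imported NON-library modules (unless `localOnly`) and from
this file. Returns (items, elapsed ms). `#h21_tree_audit ns` = prefix selector; `#h21_file_audit` = this file only. -/
def auditCore (sel : Name → Bool) (localOnly : Bool := false) (extra : Environment → TagIndex → Array Name := fun _ _ => #[]) :
    CommandElabM (Array TreeItem × Nat) := do
  let t0 ← IO.monoMsNow
  let env ← getEnv
  let ix := TagIndex.ofEnv env
  let cache : HeadIndexRef ← IO.mkRef none
  let sameModule := headedInProject env cache
  -- candidates (a fold over all of Mathlib's constants would cost ~1 s per call; project modules are few and small)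
  let mut cands : Array (Name × ConstantInfo) := #[]
  unless localOnly do
    for h : i in [0:env.header.modules.size] do
      if libraryRoots.contains env.header.modules[i].module.getRoot then continue
      let some md := env.header.moduleData[i]? | continue
      for n in md.constNames do
        if sel n then
          if let some ci := env.find? n then
            unless skipDecl env n ci do cands := cands.push (n, ci)
  cands := env.constants.foldStage2 (fun acc n ci => if sel n && !skipDecl env n ci then acc.push (n, ci) else acc) cands
  for n in extra env ix do                     -- e.g. root-namespaced statements of the audited summit
    unless sel n do
      if let some ci := env.find? n then cands := cands.push (n, ci)
  cands := cands.qsort fun a b => Name.lt a.1 b.1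
  let candSet : Std.HashSet Name := cands.foldl (fun s (n, _) => s.insert n) {}
  -- first pass
  let mut items : Array TreeItem := #[]
  for (n, ci) in cands do
    let it ← try
        liftTermElabM (classifyDecl env ix n ci sameModule)
      catch e =>
        pure { decl := n, cls := "audit.error", reason := trunc (← e.toMessageData.toString) 300, module := moduleStr env n }
    items := items.push it
  -- cone: everything reachable (used constants, restricted to the candidate set) from obligations and edges
  let rootCls := ["statement", "route_item", "route_premise", "stub", "conjecture", "proved-helper", "closes", "refutes", "refutes.conditional", "proof-of-item", "proof.conditional"]
  let mut usedBy : Std.HashMap Name Name := {}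
  let mut work : Array Name := #[]
  for it in items do
    if rootCls.contains it.cls then
      usedBy := usedBy.insert it.decl it.decl
      work := work.push it.decl
      if it.cls == "proved-helper" then         -- its witnesses (and what their proofs use) are connected through it
        for w in it.witnesses do
          unless usedBy.contains w do
            usedBy := usedBy.insert w it.decl
            work := work.push w
  while h : 0 < work.size do
    let n := work.back
    work := work.pop
    let some ci := env.find? n | continue
    for c in ci.getUsedConstantsAsSet do
      if candSet.contains c && !usedBy.contains c then
        usedBy := usedBy.insert c n
        work := work.push c
  -- second pass: support / orphan
  items := items.map fun it =>
    if it.cls == "thm?" || it.cls == "def?" then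
      match usedBy.get? it.decl with
      | some u => { it with cls := (if it.cls == "thm?" then "support" else "def"), reason := s!"used by {u}" ++ (if it.closed == some false then "; NOT closed (sorry/axiom in its cone)" else "") }
      | none => { it with cls := "orphan", closed := none, reason := "unreachable from every obligation/edge (tree.orphan)" }
    else if it.cls == "vendored-fact" then
      { it with reason := it.reason ++ (match usedBy.get? it.decl with | some u => s!"; used by {u}" | none => "; also orphan") }
    else it
  return (items, (← IO.monoMsNow) - t0)

/-- Class → meaning / one-line fix (emitted once per audit as `legend`). -/
def classLegend : List (String × String) := [
  ("statement", "@[summit_statement] decl (a parent node)"),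
  ("route_item", "@[route_item r] decl — listed obligation of route r (reason = r)"),
  ("route_premise", "@[route_premise r] decl — named conjecture of conditional-bridge route r"),
  ("stub", "@[stub l] decl — declared stub of Line l"),
  ("conjecture", "@[conjecture] decl — open named conjecture stated in our theories (obligation node: proofs of it are proof-of-item, `¬` it refutes; a route may use it only as its own item / premise)"),
  ("closes", "@[closes r] deciding theorem; reason carries glue.* codes when the layer invariant fails; closed = axioms ⊆ whitelist"),
  ("refutes", "theorem `¬ D` (or `D → False`) with D a registered obligation BY NAME and only registered hypotheses — a connected negative edge; closed = axioms ⊆ whitelist"),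
  ("refutes.conditional", "`¬ D` under unregistered hypotheses — recorded/displayed, settles nothing"),
  ("refutes.malformed", "tagged @[refutes] but not of shape `¬ D` for a registered D by name"),
  ("proof-of-item", "theorem whose type IS a registered obligation applied by name — closes it iff closed = true (collectAxioms ⊆ {propext, Classical.choice, Quot.sound})"),
  ("proof.conditional", "proves a registered obligation only under unregistered Prop hypotheses — closure.modulo display, no credit; FIX: register the hypothesis (item/stub) or discharge it"),
  ("support", "theorem in the used-constants cone of an obligation/edge (reason = one user)"),
  ("def", "non-Prop definition in that cone"),
  ("proved-helper", "untagged Prop-valued def under Summits/ that HAS a kernel-closed witness in the env (legacy proved material; excluded from vendored-fact/orphan; witnesses listed)"),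
  ("vendored-fact", "untagged Prop-valued def/abbrev/structure/predicate under Summits/ — FIX: only registered obligations may define propositions here; move it to Literature/<Topic>/… (tracked, cited debt) and reference it by name"),
  ("axiom", "an `axiom` under Summits/ — forbidden; closure is computed from axioms, so it can never count"),
  ("orphan", "not on any dependency path to a Statement/item/stub/edge — FIX: wire it in (closes / item proof / --supports use within the drift window) or retire it; the gate joins this with ledger --supports links before stamping tree.orphan"),
  ("audit.error", "the classifier failed on this decl (e.g. incoherent imports); reported, never thrown")]

/-- `#h21_tree_audit Summit.S.Sub` — see the module doc. -/
syntax (name := h21TreeAudit) "#h21_tree_audit " ident : command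

@[command_elab h21TreeAudit] def elabH21TreeAudit : CommandElab := fun stx => do
  let ns := stx[1].getId
  let j ← try
      -- statements declared at _root_ (D-0018 registry files) belong to `Summit.S` by MODULE (`Summits.S.…`), not by name
      let extra := fun (env : Environment) (ix : TagIndex) =>
        match ns with
        | .str .anonymous _ | .anonymous => (#[] : Array Name)
        | _ =>
          if ns.getRoot != `Summit then #[] else
            let modPrefix := ns.components.tail.foldl (fun (m : Name) (c : Name) => m ++ c) `Summits
            (ix.tags.filter fun t => t.attr == `summit_statement &&
                (match declModule? env t.decl with | some m => modPrefix.isPrefixOf m | none => true)).map (·.decl)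
              |>.toList.eraseDups.toArray
      let (items, ms) ← auditCore ns.isPrefixOf (extra := extra)
      let mut counts : Std.HashMap String Nat := {}
      for it in items do
        counts := counts.insert it.cls (counts.getD it.cls 0 + 1)
      let bad := ["vendored-fact", "orphan", "axiom", "refutes.malformed", "audit.error"]
      let violations := items.filter fun it => bad.contains it.cls
      pure <| Json.mkObj [
        (treeMarker, (ns.toString : Json)), ("namespace", (ns.toString : Json)),
        ("ok", (violations.isEmpty : Json)),
        ("counts", Json.mkObj (counts.toList.map fun (k, v) => (k, (v : Json)))),
        ("n", (items.size : Json)), ("elapsed_ms", (ms : Json)),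
        ("legend", Json.mkObj (classLegend.map fun (k, v) => (k, (v : Json)))),
        ("items", Json.arr (items.map TreeItem.toJson)), ("v", (1 : Json))]
    catch e =>
      let msg ← e.toMessageData.toString
      pure <| Json.mkObj [(treeMarker, (ns.toString : Json)), ("namespace", (ns.toString : Json)), ("ok", false),
        ("error", (trunc msg 500 : Json)), ("counts", Json.mkObj []), ("items", Json.arr #[]), ("v", (1 : Json))]
  logInfo j.compress

/-! ## `#h21_file_audit` — the same classification restricted to THIS file (seat-side self-check in `lean check`) -/

/-- JSON key / marker of the file-audit line. -/
def fileMarker : String := "h21_file_audit"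

/-- `#h21_file_audit` — classify every declaration DECLARED IN THIS FILE exactly like `#h21_tree_audit` (obligation tags
from imports count; the cone is computed within the file, so `orphan` means "nothing in this file that connects to the
tree uses it"). One info line `{"h21_file_audit": <module>, "module", "counts", "items":[{decl,class,reason,module,
target?,closed?}], "n", "elapsed_ms", "ok", "v":1}`. Cheap: no imported constants are visited. -/
syntax (name := h21FileAudit) "#h21_file_audit" : command

@[command_elab h21FileAudit] def elabH21FileAudit : CommandElab := fun _stx => do
  let modName := (← getEnv).mainModule.toString
  let j ← try
      let (items, ms) ← auditCore (fun _ => true) (localOnly := true)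
      let mut counts : Std.HashMap String Nat := {}
      for it in items do
        counts := counts.insert it.cls (counts.getD it.cls 0 + 1)
      let bad := ["vendored-fact", "orphan", "axiom", "refutes.malformed", "proof.conditional", "refutes.conditional", "audit.error"]
      let violations := items.filter fun it => bad.contains it.cls || it.closed == some false
      pure <| Json.mkObj [
        (fileMarker, (modName : Json)), ("module", (modName : Json)), ("ok", (violations.isEmpty : Json)),
        ("counts", Json.mkObj (counts.toList.map fun (k, v) => (k, (v : Json)))),
        ("n", (items.size : Json)), ("elapsed_ms", (ms : Json)),
        ("items", Json.arr (items.map TreeItem.toJson)), ("v", (1 : Json))]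
    catch e =>
      let msg ← e.toMessageData.toString
      pure <| Json.mkObj [(fileMarker, (modName : Json)), ("module", (modName : Json)), ("ok", false),
        ("error", (trunc msg 500 : Json)), ("counts", Json.mkObj []), ("items", Json.arr #[]), ("v", (1 : Json))]
  logInfo j.compress

/-! ## `#h21_route_deps` — the project-side dependency cone of a route (staffability: "prop-free down to Mathlib") -/

/-- JSON key / marker of the route-deps line. -/
def depsMarker : String := "h21_route_deps"

/-- Listed-constant cap of `#h21_route_deps` (beyond it `truncated: true`). -/
def depsCap : Nat := 5000

/-- Kind string of a constant for the deps report. -/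
def constKind (env : Environment) (n : Name) (ci : ConstantInfo) : MetaM String := do
  match ci with
  | .axiomInfo _ => return "axiom"
  | .opaqueInfo _ => return "opaque"
  | .thmInfo _ => return "theorem"
  | .inductInfo _ => return if isStructure env n then "structure" else "inductive"
  | .defnInfo d =>
    if Meta.isInstanceCore env n then return "instance"
    if ← definesProp ci.type then return if d.hints.isAbbrev then "prop_abbrev" else "prop_def"
    return "def"
  | .ctorInfo _ => return "constructor"
  | .recInfo _ => return "recursor"
  | .quotInfo _ => return "quot"

/-- `#h21_route_deps "route-id"` — see `routeDepsCore`. -/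
syntax (name := h21RouteDeps) "#h21_route_deps " str : command

/--
The project-side dependency cone of route `rid` in the current file. Roots = local decls tagged `route_item rid` / `stub rid`,
the local `@[closes rid]` theorem(s), and local theorems whose type head is one of those roots (`_holds`, item proofs).
Walk `getUsedConstants` of type AND value transitively; descend only into PROJECT constants (`isProjectConst`; Mathlib /
Init / Std / Batteries / Lean / … are the trusted floor: not descended, not listed); auto-generated names are walked
through but not listed. Per listed constant: kind, module, axioms (collectAxioms, every kind), sorry, and for
`prop_def`/`prop_abbrev` the `holds` witnesses found in the environment — `X_holds`, `X.holds`, and any theorem of X's own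
module (or this file) whose type is exactly `X` applied to its binders — each with its axioms; `cite_only` = tagged
@[cite]/@[claim]/@[cite_pending]/@[folklore] or doc `[cite` and no holds; `route_item_of` = rid when the constant is one
of this route's registered items/stubs; `explicit_binders` = number of default-explicit binders of the constant's type
telescope (0 ⇒ a closed FACT needing a witness, >0 ⇒ a predicate / vocabulary); `via_statement_only` = reachable only
through a `@[summit_statement]` constant (the route's target side, not a dependency). Policy (what counts as unproved,
compute carve-outs) is the gate's.
-/
def routeDepsCore (rid : String) : CommandElabM Json := do
  let t0 ← IO.monoMsNow
  let env ← getEnv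
  let ix := TagIndex.ofEnv env
  -- roots
  let isLocal (n : Name) : Bool := (env.getModuleIdxFor? n).isNone
  let itemRoots := ix.tags.filter fun t =>
    (t.attr == `route_item || t.attr == `stub) && t.arg == rid && t.origin.isNone && isLocal t.decl && env.contains t.decl
  let itemSet : Std.HashSet Name := itemRoots.foldl (fun s t => s.insert t.decl) {}
  let closesRoots := (ix.tags.filter fun t => t.attr == `closes && t.arg == rid && t.origin.isNone && env.contains t.decl).map (·.decl)
  let mut roots : Array Name := (itemRoots.map (·.decl)) ++ closesRoots
  -- local theorems whose type head is an item root (`_holds`, GlueBy, item proofs in this file)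
  roots := env.constants.foldStage2 (fun acc n ci =>
    match ci with
    | .thmInfo _ =>
      match ci.type.getForallBody.getAppFn.constName? with
      | some h => if itemSet.contains h && !acc.contains n then acc.push n else acc
      | none => acc
    | _ => acc) roots
  roots := (roots.toList.eraseDups).toArray
  -- cone walk (worklist; walk through everything project-side, list the non-auto ones). Pass 1 stops at
  -- @[summit_statement] constants (listed, not descended); pass 2 descends them too: what only pass 2 reaches is
  -- `via_statement_only` (the route's TARGET side, not a dependency).
  let isStatement (c : Name) : Bool := ix.hasAttr c `summit_statement
  let mut seen : Std.HashSet Name := {}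
  let mut direct : Std.HashSet Name := {}
  let mut listed : Array Name := #[]
  let mut truncated := false
  for pass in [1, 2] do
    let mut work : Array Name := #[]
    if pass == 1 then
      for r in roots do
        unless seen.contains r do seen := seen.insert r; work := work.push r
    else
      direct := seen
      for r in listed do
        if isStatement r then work := work.push r
    while h : 0 < work.size do
      let n := work.back
      work := work.pop
      let some ci := env.find? n | continue
      unless pass == 2 && isStatement n do          -- statements were listed in pass 1
        unless skipDecl env n ci do
          if listed.size < depsCap then listed := listed.push n else truncated := true
      if pass == 1 && isStatement n && !roots.contains n then continue
      -- theorems: walk the STATEMENT only — what a proof uses is accounted for by `axioms` (collectAxioms walks proofs, cached),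
      -- and elaborated proof terms are the expensive part (seconds for a route cone); defs/abbrevs/instances: type + value
      let used := match ci with
        | .thmInfo t => t.type.getUsedConstantsAsSet
        | _ => ci.getUsedConstantsAsSet
      for c in used do
        if !seen.contains c && isProjectConst env c then
          seen := seen.insert c
          work := work.push c
  -- axioms per listed constant; project-side axioms reached only through proofs are listed too (kind `axiom`)
  let mut axMap : Std.HashMap Name (Array Name) := {}
  let mut extra : Array Name := #[]
  for n in listed do
    let axs ← liftCoreM (collectAxioms n)
    axMap := axMap.insert n axs
    for a in axs do
      if a != ``sorryAx && !axiomWhitelist.contains a && isProjectConst env a && !axMap.contains a && !extra.contains a then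
        extra := extra.push a
  for a in extra do
    unless axMap.contains a do axMap := axMap.insert a #[a]
  listed := (listed ++ extra.filter fun a => !listed.contains a).qsort Name.lt
  -- per-module index of theorems by type head (for `holds` search), built lazily
  let cache : HeadIndexRef ← IO.mkRef none
  let sameModule := headedInProject env cache
  let mut consts : Array Json := #[]
  for n in listed do
    let some ci := env.find? n | continue
    let kind ← liftTermElabM (constKind env n ci)
    let axs := axMap.getD n #[]
    let modName := match declModule? env n with | some m => m | none => env.mainModule
    let explicitBinders : Nat ← liftTermElabM <| forallTelescope ci.type fun xs _ => do
      let mut k : Nat := 0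
      for x in xs do
        if (← x.fvarId!.getDecl).binderInfo == .default then k := k + 1
      return k
    let mut fields : List (String × Json) := [
      ("const", (n.toString : Json)), ("module", (modName.toString : Json)), ("kind", (kind : Json)),
      ("explicit_binders", (explicitBinders : Json)), ("via_statement_only", (!(direct.contains n || extra.contains n) : Json)),
      ("axioms", strArr (axs.map (·.toString))), ("sorry", (axs.contains ``sorryAx : Json)),
      ("tags", strArr (((ix.of n).filter (·.attr != `route_item_kind)).map (fun t => t.attr.toString) |>.toList.eraseDups.toArray)),
      ("item_kind", match ix.itemKind? n with | some k => (k : Json) | none => Json.null),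
      ("route_item_of", if itemSet.contains n then (rid : Json) else
        match (ix.of n).find? (fun t => (t.attr == `route_item || t.attr == `stub) && t.arg == rid) with
        | some _ => (rid : Json) | none => Json.null)]
    if kind == "prop_def" || kind == "prop_abbrev" then
      let ws ← liftTermElabM (holdsWitnesses sameModule n)
      let holds := ws.map fun w => Json.mkObj [("thm", (w.thm.toString : Json)), ("axioms", strArr (w.axioms.map (·.toString))), ("sorry", (w.sorry : Json))]
      let cited := (HarnessLib.tagsOf env n).any (fun t => [`cite, `claim, `cite_pending, `folklore].contains t.attr) ||
        (match ← findDocString? env n with | some d => (d.splitOn "[cite").length > 1 || (d.splitOn "[claim").length > 1 | none => false)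
      fields := fields ++ [("holds", Json.arr holds), ("cite_only", (cited && holds.isEmpty : Json)), ("cited", (cited : Json))]
    consts := consts.push (Json.mkObj fields)
  return Json.mkObj [
    (depsMarker, (rid : Json)), ("v", (1 : Json)), ("roots", strArr (roots.map (·.toString))),
    ("n", (consts.size : Json)), ("truncated", (truncated : Json)), ("consts", Json.arr consts),
    ("elapsed_ms", (((← IO.monoMsNow) - t0 : Nat) : Json))]

@[command_elab h21RouteDeps] def elabH21RouteDeps : CommandElab := fun stx => do
  let rid := (stx[1].isStrLit?).getD ""
  let j ← try routeDepsCore rid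
    catch e =>
      let msg ← e.toMessageData.toString
      pure <| Json.mkObj [(depsMarker, (rid : Json)), ("v", (1 : Json)), ("roots", Json.arr #[]), ("n", (0 : Json)),
        ("truncated", false), ("consts", Json.arr #[]), ("error", (trunc msg 500 : Json))]
  logInfo j.compress

/-! ## `#h21_check_skeleton` — A12 minimal skeleton audit (crux proof skeleton with declared stubs) -/

/-- JSON key / marker of the skeleton verdict line. -/
def skeletonMarker : String := "h21_check_skeleton"

/-- User-facing owner of a (possibly auxiliary/internal) declaration name: strips trailing internal components
(`foo._proof_1`, `foo.match_1`, numeric parts) so a sorry inside an aux decl is attributed to `foo`. -/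
def userOwner : Name → Name
  | .anonymous => .anonymous
  | n@(.str p s) =>
    let p' := userOwner p
    if p' != p then p' else if s.startsWith "_" || s.startsWith "match_" || s.startsWith "proof_" || s.startsWith "eq_" then p else n
  | .num p _ => userOwner p

/-- `#h21_check_skeleton "<crux-item-id>" Crux.Decl.FQ stub₁ stub₂ …` — the layer invariant for a seat's Line skeleton file:
ok iff (i) some theorem DECLARED IN THIS FILE concludes the crux decl BY NAME (no unfolding), (ii) it takes no `Prop`
hypotheses other than registered obligations (route items / stubs / conjectures / statements by name), (iii) every DIRECT
use of `sorryAx` in this file sits in a declaration whose short name is one of the listed stubs, (iv) no `axiom` is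
declared here and the skeleton's axioms ⊆ whitelist ∪ {sorryAx}. Codes: skeleton.missing · skeleton.conclusion-mismatch ·
skeleton.extra-hypothesis · skeleton.unregistered-sorry · skeleton.axiom · audit.error. One info line
`{"h21_check_skeleton": item, "crux", "ok", "codes", "details", "theorem", "closed" (skeleton sorry-free & clean),
"stubs":[{name, decl|null, signature, sorried}], "sorries":[decl…], "elapsed_ms", "v":1}`. -/
syntax (name := h21CheckSkeleton) "#h21_check_skeleton " str (ppSpace ident)+ : command

def checkSkeletonCore (item : String) (crux : Name) (stubs : Array Name) : CommandElabM Json := do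
  let t0 ← IO.monoMsNow
  let env ← getEnv
  let ix := TagIndex.ofEnv env
  let mut rep : GlueReport := {}
  -- local declarations
  let locals : Array (Name × ConstantInfo) := env.constants.foldStage2 (fun acc n ci => acc.push (n, ci)) #[]
  -- (i) candidate skeleton theorems: conclusion head = crux, by name
  let mut cands : Array Name := #[]
  let mut near : Array (Name × Name) := #[]          -- (thm, head) whose head is a local def unfolding to crux
  for (n, ci) in locals do
    if skipDecl env n ci then continue
    unless ci matches .thmInfo _ do continue
    match ci.type.getForallBody.getAppFn.constName? with
    | some h =>
      if h == crux then cands := cands.push n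
      else if let some (.defnInfo d) := env.find? h then
        if d.value.getAppFn.isConstOf crux && (env.getModuleIdxFor? h).isNone then near := near.push (n, h)
    | none => pure ()
  let stubShort (n : Name) : Bool := match userOwner n with
    | .str _ s => stubs.any fun st => st.toString == s || st == userOwner n
    | _ => false
  -- (iii) direct sorries (values read from the non-exporting view of the environment, where proof bodies are visible)
  let penv := env.setExporting false
  let mut sorries : Array Name := #[]
  for (n, _) in locals do
    let some ci := penv.find? n | continue
    let direct := match ci.value? (allowOpaque := true) with
      | some v => v.getUsedConstants.contains ``sorryAx || ci.type.getUsedConstants.contains ``sorryAx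
      | none => ci.type.getUsedConstants.contains ``sorryAx
    if direct then
      let owner := userOwner n
      unless sorries.contains owner do sorries := sorries.push owner
  for o in sorries do
    unless stubShort o do
      rep := rep.push { code := "skeleton.unregistered-sorry", decl := o, term := o.toString,
                        fix := s!"`sorry` is allowed only inside the DECLARED stubs {stubs.toList}; make this a named stub (declare it) or prove it" }
  -- (iv) local axioms
  for (n, ci) in locals do
    if let .axiomInfo _ := ci then
      rep := rep.push { code := "skeleton.axiom", decl := n, term := n.toString, fix := "no axioms in a skeleton: state it as a stub `theorem … := by sorry` instead" }
  -- (i)/(ii) the skeleton theorem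
  let mut thm : Option Name := none
  let mut closed := false
  match cands.toList with
  | [] =>
    if let some (n, h) := near[0]? then
      rep := rep.push { code := "skeleton.conclusion-mismatch", decl := n, term := h.toString,
                        fix := s!"conclude `{crux}` BY NAME — `{h}` merely unfolds to it" }
    else
      rep := rep.push { code := "skeleton.missing", term := crux.toString,
                        fix := s!"declare `theorem <Crux>_proof : {crux} := …` in this file (stubs may be `sorry`)" }
  | c :: more =>
    thm := some c
    let ci := (env.find? c).get!
    let admissible (h : Name) : Bool := ix.isTagged h || stubs.any (fun st => match h with | .str _ s => st.toString == s || st == h | _ => false)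
    let sub ← liftTermElabM <| analyseGlue c ci.type (· == crux) admissible s!"`{crux}`" "registered obligations / declared stubs"
    for d in sub.details do
      if d.code == "glue.extra-hypothesis" then
        rep := rep.push { d with code := "skeleton.extra-hypothesis" }
      else if d.code == "glue.axiom" then
        rep := rep.push { d with code := "skeleton.axiom" }
      else if d.code == "glue.conclusion-mismatch" then
        rep := rep.push { d with code := "skeleton.conclusion-mismatch" }
    closed := sub.ok           -- no sorry, no axiom, right shape: the skeleton IS the crux proof
    unless more.isEmpty do
      let note : Detail := { code := "skeleton.note", decl := c, term := ", ".intercalate (more.map (·.toString)),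
                             fix := "several theorems conclude the crux; the first is taken as the skeleton" }
      rep := { rep with details := rep.details.push note }
  -- stubs report
  let mut stubsJ : Array Json := #[]
  for st in stubs do
    let hit := locals.find? fun (n, ci) => !skipDecl env n ci && (match n with | .str _ s => st.toString == s || n == st | _ => false)
    match hit with
    | some (n, ci) =>
      let sig ← liftTermElabM (ppTerm ci.type)
      stubsJ := stubsJ.push (Json.mkObj [("name", (st.toString : Json)), ("decl", (n.toString : Json)), ("signature", (sig : Json)),
                                         ("sorried", (sorries.contains n : Json))])
    | none =>
      stubsJ := stubsJ.push (Json.mkObj [("name", (st.toString : Json)), ("decl", Json.null), ("signature", (("" : String) : Json)), ("sorried", false)])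
  return Json.mkObj [
    (skeletonMarker, (item : Json)), ("crux", (crux.toString : Json)), ("ok", (rep.ok : Json)), ("codes", strArr rep.codes),
    ("details", Json.arr (rep.details.map Detail.toJson)),
    ("theorem", match thm with | some t => (t.toString : Json) | none => Json.null), ("closed", (closed : Json)),
    ("stubs", Json.arr stubsJ), ("sorries", strArr (sorries.map (·.toString))),
    ("elapsed_ms", (((← IO.monoMsNow) - t0 : Nat) : Json)), ("v", (1 : Json))]

@[command_elab h21CheckSkeleton] def elabH21CheckSkeleton : CommandElab := fun stx => do
  let item := (stx[1].isStrLit?).getD ""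
  let ids := stx[2].getArgs.map fun a => a.getId.replacePrefix `_root_ .anonymous
  let crux := ids[0]!
  let stubs := ids.extract 1 ids.size
  let j ← try checkSkeletonCore item crux stubs
    catch e =>
      let msg ← e.toMessageData.toString
      pure <| Json.mkObj [(skeletonMarker, (item : Json)), ("crux", (crux.toString : Json)), ("ok", false), ("codes", strArr #["audit.error"]),
        ("details", Json.arr #[Detail.toJson { code := "audit.error", term := trunc msg 500, fix := "internal audit failure" }]), ("v", (1 : Json))]
  logInfo j.compress

/-! ## `#h21_ground` — cheap grounding of a route's items (trivial / false / vacuous / unused binder / name shadow) -/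

/-- JSON key / marker of the ground line. -/
def groundMarker : String := "h21_ground"

register_option h21.ground.tacticHeartbeats : Nat := {
  defValue := 1200
  descr := "#h21_ground: maxHeartbeats (×1000) per tactic attempt" }
register_option h21.ground.itemMs : Nat := {
  defValue := 800
  descr := "#h21_ground: wall-clock budget per item (ms; checked between tactic attempts)" }
register_option h21.ground.librarySearch : Bool := {
  defValue := false
  descr := "#h21_ground: also try `exact?` (first use per process pays the library index build, ~10 s+)" }
register_option h21.ground.maxBinders : Nat := {
  defValue := 40
  descr := "#h21_ground: statements with more ∀-binders than this get no battery (listed in skipped)" }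
register_option h21.ground.maxSize : Nat := {
  defValue := 100000
  descr := "#h21_ground: statements whose definiens is larger (Expr.sizeWithoutSharing) get no battery; cost is bounded by heartbeats anyway" }
register_option h21.ground.totalMs : Nat := {
  defValue := 8000
  descr := "#h21_ground: wall-clock budget for all batteries of the command (ms)" }

/-- Budget knobs of `#h21_ground` (defaults; the command reads the `h21.ground.*` options). -/
structure GroundCfg where
  /-- heartbeats per tactic attempt (option units, i.e. ×1000 raw); a few hundred ms of search. -/
  tacticHeartbeats : Nat := 1200
  /-- stop an item's batteries after this many ms. -/
  itemBudgetMs : Nat := 800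
  /-- stop running batteries (not the cheap checks) after this many ms in total. -/
  totalBudgetMs : Nat := 8000
  /-- statements with more binders / larger terms are not batteried (`skipped`). -/
  maxBinders : Nat := 40
  maxSize : Nat := 100000
  /-- include `exact?` in the batteries -/
  librarySearch : Bool := false
  deriving Inhabited

/-- Positive battery: tries to PROVE the statement. -/
def groundPosTactics : Array String :=
  #["intros; rfl", "intros; trivial", "decide", "intros; omega", "intros; linarith", "intros; positivity", "intros; simp_all", "intros; norm_num",
    "intros; ring", "tauto", "intros; aesop", "intros; exact?"]
/-- Negative battery: tries to prove `¬ statement`. -/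
def groundNegTactics : Array String :=
  #["decide", "intro h; omega", "push_neg; intros; omega", "push_neg; intros; linarith", "intro h; simp_all", "push_neg; intros; norm_num",
    "push_neg; intros; simp_all", "intro h; aesop", "intro h; exact?"]
/-- Counterexample search run ON the statement (a failure message "Found a counter-example!" is the witness). -/
def groundWitnessTactics : Array String := #["intros; plausible"]
/-- Vacuity battery: hypotheses of the statement ⊢ False. -/
def groundVacTactics : Array String :=
  #["contradiction", "omega", "linarith", "decide", "simp_all", "norm_num at *", "aesop"]

/-- Outcome of one tactic attempt. -/
inductive TacOutcome where
  | closed (proof : Expr)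
  | failed (msg : String)
  | unavailable            -- the tactic does not parse in this environment (e.g. Mathlib not imported)

/-- Run tactic source `tac` against a fresh goal of type `goal` (in the current local context) under a heartbeat cap.
Never throws; environment/message side effects are the caller's to discard. -/
def tryTacticOn (goal : Expr) (tac : String) (heartbeats : Nat) : TermElabM TacOutcome := do
  let env ← getEnv
  -- `t₁; t₂` is a tactic SEQUENCE; parenthesised it is one tactic
  match Parser.runParserCategory env `tactic s!"({tac})" "<h21_ground>" with
  | .error _ => return .unavailable
  | .ok stx =>
    let g ← mkFreshExprMVar (some goal) (kind := .syntheticOpaque)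
    let start ← IO.getNumHeartbeats
    withTheReader Core.Context (fun c => { c with initHeartbeats := start, maxHeartbeats := heartbeats * 1000 }) do
      tryCatchRuntimeEx
        (do
          let gs ← Term.withoutErrToSorry <| withoutModifyingEnv <| Tactic.run g.mvarId! (Tactic.evalTactic stx)
          unless gs.isEmpty do return .failed "goals remain"
          let pf ← instantiateMVars g
          if pf.hasExprMVar then return .failed "unassigned metavariables"
          if pf.getUsedConstants.contains ``sorryAx then return .failed "proof uses sorry"
          return .closed pf)
        (fun e => do return .failed (trunc (← e.toMessageData.toString) 300))

/-- Project theorems a proof term leans on (for `ground.in-tree`). -/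
def projectTheoremsIn (env : Environment) (pf : Expr) : Array Name :=
  pf.getUsedConstants.filter fun c => isProjectConst env c && (match env.find? c with | some (.thmInfo _) => true | _ => false)

/-- Battery bookkeeping: tactics that do not exist here, and a per-attempt trace `(phase, tactic, ms, outcome)`. -/
structure BatteryLog where
  unavailable : Array String := #[]
  trace : Array (String × String × Nat × String) := #[]

/-- Run a battery until the first success; returns the flag (code, detail) if any, logging attempts into `log`. -/
def runBattery (env : Environment) (goal : Expr) (tacs : Array String) (cfg : GroundCfg) (code phase : String) (deadlineMs : Nat)
    (log : BatteryLog) : TermElabM (Option (String × String) × BatteryLog) := do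
  let mut log := log
  for tac in tacs do
    if !cfg.librarySearch && (tac.splitOn "exact?").length > 1 then continue
    if (← IO.monoMsNow) > deadlineMs then
      log := { log with trace := log.trace.push (phase, tac, 0, "deadline") }
      break
    let a ← IO.monoMsNow
    let r ← tryTacticOn goal tac cfg.tacticHeartbeats
    let ms := (← IO.monoMsNow) - a
    match r with
    | .closed pf =>
      log := { log with trace := log.trace.push (phase, tac, ms, "closed") }
      let thms := projectTheoremsIn env pf
      if code == "ground.trivial" && !thms.isEmpty then
        return (some ("ground.in-tree", s!"{tac} ⊢ closes it with tree lemma(s) {thms.toList}"), log)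
      return (some (code, if thms.isEmpty then tac else s!"{tac} (uses {thms.toList})"), log)
    | .unavailable => log := { log with unavailable := log.unavailable.push tac, trace := log.trace.push (phase, tac, ms, "unavailable") }
    | .failed msg => log := { log with trace := log.trace.push (phase, tac, ms, "failed: " ++ trunc msg 60) }
  return (none, log)

/-- `#h21_ground "route-id"` — see `groundCore`. -/
syntax (name := h21Ground) "#h21_ground " str : command

/--
Cheap grounding of every LOCAL `@[route_item rid]` decl `def D : Prop := stmt` (human decision 2026-08-15: a route is READY
when it passes the refuter + this ground). Per item, on the definiens `stmt` (never on the name):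
(a) positive battery (`groundPosTactics`) ⇒ `ground.trivial {tactic}` or `ground.in-tree {lemmas}` when the found proof
leans on project theorems; (b) negative battery on `¬ stmt` ⇒ `ground.false-witness {tactic}`, plus `plausible` on `stmt`
whose "Found a counter-example!" failure is reported as the witness; (c) the statement's own hypotheses ⊢ `False` by
`groundVacTactics` ⇒ `ground.vacuous-antecedent`; (d) data binders that neither the body nor another binder mentions ⇒
`ground.unused-binder {names}`; (e) constants used by `stmt` whose SHORT name also names a different declaration of
this file or of an enclosing namespace of the item ⇒ `ground.name-shadow {ident, resolved, others}`.
Batteries are heartbeat-capped per tactic and time-boxed per item / per command; statements over `maxBinders` /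
`maxSize` get only (d)/(e) and are listed in `skipped`. Environment and message side effects of the attempts are
discarded. One info line `{"h21_ground": rid, "v":1, "items":[{decl, flags:[{code, detail}], tried_ms, batteries}],
"skipped":[…], "unavailable":[tactics that do not exist here], "tactics":{pos,neg,witness,vac}, "elapsed_ms"}`.
-/
def groundCore (rid : String) (cfg : GroundCfg := {}) : CommandElabM Json := do
  let t0 ← IO.monoMsNow
  let env ← getEnv
  let ix := TagIndex.ofEnv env
  let items := (ix.tags.filter fun t => t.attr == `route_item && t.arg == rid && t.origin.isNone &&
      (env.getModuleIdxFor? t.decl).isNone && env.contains t.decl).map (·.decl) |>.toList.eraseDups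
  -- short-name index over project constants (for name-shadow)
  let mut shortIdx : Std.HashMap String (Array Name) := {}
  for h : i in [0:env.header.modules.size] do
    if libraryRoots.contains env.header.modules[i].module.getRoot then continue
    let some md := env.header.moduleData[i]? | continue
    for n in md.constNames do
      if n.isInternal || env.isAutoDecl n then continue
      if let .str _ s := n then shortIdx := shortIdx.insert s ((shortIdx.getD s #[]).push n)
  shortIdx := env.constants.foldStage2 (fun m n _ =>
    if n.isInternal || env.isAutoDecl n then m else
      match n with | .str _ s => m.insert s ((m.getD s #[]).push n) | _ => m) shortIdx
  let mut itemsJ : Array Json := #[]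
  let mut skipped : Array String := #[]
  let mut unavailable : Array String := #[]
  let mut remaining := items.length
  for d in items do
    let ti ← IO.monoMsNow
    remaining := remaining - 1
    let some (.defnInfo di) := env.find? d | continue
    let stmt := di.value
    let ns := d.getPrefix
    let mut flags : Array (String × String) := #[]
    -- (d) unused data binders + shape facts
    let (nBinders, unused, hasPropHyp) ← liftTermElabM <| forallTelescope stmt fun xs body => do
      let mut unused : Array String := #[]
      let mut hasPropHyp := false
      for x in xs do
        let ld ← x.fvarId!.getDecl
        let ty ← instantiateMVars ld.type
        if ← isProp ty then hasPropHyp := true; continue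
        if ld.binderInfo.isInstImplicit then continue
        let fv := x.fvarId!
        let mut used := body.containsFVar fv
        unless used do
          for y in xs do
            if y != x && (← inferType y).containsFVar fv then used := true; break
        unless used do unused := unused.push s!"{ld.userName}"
      return (xs.size, unused, hasPropHyp)
    unless unused.isEmpty do flags := flags.push ("ground.unused-binder", ", ".intercalate unused.toList)
    -- (e) name shadow (aliases — one is a def/abbrev whose body is exactly the other — are not shadows)
    let isAlias (a b : Name) : Bool :=
      (match env.find? a with | some (.defnInfo d) => d.value.getAppFn.isConstOf b | _ => false) ||
      (match env.find? b with | some (.defnInfo d) => d.value.getAppFn.isConstOf a | _ => false)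
    for c in stmt.getUsedConstants do
      let .str _ s := c | continue
      let others := (shortIdx.getD s #[]).filter fun c' =>
        c' != c && !isAlias c c' && ((env.getModuleIdxFor? c').isNone || c'.getPrefix.isPrefixOf ns)
      unless others.isEmpty do
        flags := flags.push ("ground.name-shadow", s!"{s} ↦ {c}; also declared: {others.toList}")
    -- batteries
    let size := stmt.sizeWithoutSharing
    let mut batteries := false
    let mut trace : Array (String × String × Nat × String) := #[]
    -- fair share: the item budget shrinks so the remaining items still fit the command budget (never below 250 ms)
    let spent := (← IO.monoMsNow) - t0
    let left := if spent ≥ cfg.totalBudgetMs then 0 else cfg.totalBudgetMs - spent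
    let share := max 250 (min cfg.itemBudgetMs (left / (remaining + 1)))
    let over := left < 250
    if nBinders > cfg.maxBinders || size > cfg.maxSize then
      skipped := skipped.push d.toString
      flags := flags.push ("ground.skipped", s!"binders {nBinders} / size {size} over the battery cap")
    else if over then
      skipped := skipped.push d.toString
      flags := flags.push ("ground.skipped", "command time budget exhausted before this item")
    else
      batteries := true
      let deadline := (← IO.monoMsNow) + share
      let saved := (← get).messages
      let (fs, log) ← withoutModifyingEnv <| liftTermElabM <| do
        let mut fs : Array (String × String) := #[]
        let mut log : BatteryLog := {}
        -- (a) trivially provable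
        let (f, l) ← runBattery env stmt groundPosTactics cfg "ground.trivial" "pos" deadline log
        log := l
        let proved := f.isSome
        if let some f := f then fs := fs.push f
        -- (b) false: ¬ stmt provable, or plausible finds a counter-example on stmt (pointless once proved)
        unless proved do
          let (f, l) ← runBattery env (mkNot stmt) groundNegTactics cfg "ground.false-witness" "neg" deadline log
          log := l
          match f with
          | some f => fs := fs.push f
          | none =>
            for tac in groundWitnessTactics do
              if (← IO.monoMsNow) > deadline then break
              let a ← IO.monoMsNow
              let r ← tryTacticOn stmt tac cfg.tacticHeartbeats
              let ms := (← IO.monoMsNow) - a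
              match r with
              | .failed msg =>
                let hit := (msg.splitOn "counter-example").length > 1
                log := { log with trace := log.trace.push ("witness", tac, ms, if hit then "counter-example" else "failed: " ++ trunc msg 60) }
                if hit then fs := fs.push ("ground.false-witness", s!"{tac}: {trunc msg 200}"); break
              | .unavailable => log := { log with unavailable := log.unavailable.push tac, trace := log.trace.push ("witness", tac, ms, "unavailable") }
              | .closed _ => log := { log with trace := log.trace.push ("witness", tac, ms, "closed") }; fs := fs.push ("ground.trivial", tac); break
        -- (c) vacuous antecedents
        if hasPropHyp then
          let (f, l) ← forallTelescope stmt fun _ _ => do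
            runBattery env (mkConst ``False) groundVacTactics cfg "ground.vacuous-antecedent" "vac" deadline log
          log := l
          if let some f := f then fs := fs.push f
        return (fs, log)
      modify fun st => { st with messages := saved }
      flags := flags ++ fs
      trace := log.trace
      for u in log.unavailable do unless unavailable.contains u do unavailable := unavailable.push u
    itemsJ := itemsJ.push (Json.mkObj [
      ("decl", (d.toString : Json)),
      ("flags", Json.arr (flags.map fun (c, det) => Json.mkObj [("code", (c : Json)), ("detail", (det : Json))])),
      ("tried_ms", (((← IO.monoMsNow) - ti : Nat) : Json)), ("batteries", (batteries : Json)),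
      ("trace", Json.arr (trace.map fun (ph, tac, ms, o) => Json.mkObj [("phase", (ph : Json)), ("tactic", (tac : Json)), ("ms", (ms : Json)), ("outcome", (o : Json))])),
      ("binders", (nBinders : Json)), ("size", (size : Json))])
  return Json.mkObj [
    (groundMarker, (rid : Json)), ("v", (1 : Json)), ("items", Json.arr itemsJ), ("skipped", strArr skipped),
    ("unavailable", strArr unavailable),
    ("tactics", Json.mkObj [("pos", strArr groundPosTactics), ("neg", strArr groundNegTactics), ("witness", strArr groundWitnessTactics), ("vac", strArr groundVacTactics)]),
    ("elapsed_ms", (((← IO.monoMsNow) - t0 : Nat) : Json))]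

@[command_elab h21Ground] def elabH21Ground : CommandElab := fun stx => do
  let rid := (stx[1].isStrLit?).getD ""
  let opts ← getOptions
  let cfg : GroundCfg := { tacticHeartbeats := h21.ground.tacticHeartbeats.get opts, itemBudgetMs := h21.ground.itemMs.get opts,
                           totalBudgetMs := h21.ground.totalMs.get opts, librarySearch := h21.ground.librarySearch.get opts,
                           maxBinders := h21.ground.maxBinders.get opts, maxSize := h21.ground.maxSize.get opts }
  let j ← try groundCore rid cfg
    catch e =>
      let msg ← e.toMessageData.toString
      pure <| Json.mkObj [(groundMarker, (rid : Json)), ("v", (1 : Json)), ("items", Json.arr #[]), ("skipped", Json.arr #[]),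
        ("error", (trunc msg 500 : Json))]
  logInfo j.compress

/-! ## env linters (Batteries `#lint`) — the per-declaration checks, for interactive / CI use -/

/-- Untagged `Prop` definitions under `Summit.*` (tree.vendored-fact). -/
@[env_linter] def h21VendoredFact : Batteries.Tactic.Lint.Linter where
  noErrorsFound := "no untagged Prop definitions under Summit.* (D-0027 §2.1)"
  errorsFound := "UNTAGGED PROP DEFINITIONS UNDER Summit.* — tree.vendored-fact (D-0027 §2.1: move to Literature/ and cite by name):"
  test declName := do
    unless (`Summit).isPrefixOf declName do return none
    let env ← getEnv
    let some ci := env.find? declName | return none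
    if skipDecl env declName ci then return none
    let it ← classifyDecl env (TagIndex.ofEnv env) declName ci
    return if it.cls == "vendored-fact" || it.cls == "axiom" then some m!"{it.reason}" else none

/-- Theorems under `Summit.*` proving / refuting a registered obligation under UNREGISTERED hypotheses. -/
@[env_linter] def h21ConditionalProof : Batteries.Tactic.Lint.Linter where
  noErrorsFound := "no conditional proofs/refutations of registered obligations under Summit.* (D-0027 §2.1)"
  errorsFound := "CONDITIONAL PROOFS UNDER Summit.* — proof.conditional / refutes.conditional (D-0027 §2.1: hypotheses must be registered obligations by name):"
  test declName := do
    unless (`Summit).isPrefixOf declName do return none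
    let env ← getEnv
    let some ci := env.find? declName | return none
    if skipDecl env declName ci then return none
    let it ← classifyDecl env (TagIndex.ofEnv env) declName ci
    return if it.cls == "proof.conditional" || it.cls == "refutes.conditional" || it.cls == "refutes.malformed"
      then some m!"{it.reason}" else none

end HarnessLib.Audit
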